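import Mathlib
import HarnessLib
import Literature.Analysis.FluidPDE.MillerEnstrophyProductionIdentity
import Literature.Analysis.FluidPDE.SerrinEnstrophyGronwall
import Summits.NavierStokesRegularity.NavierStokesRegularity.Theorems.PlaneStrainDoorProfileGradientDecay
import Summits.NavierStokesRegularity.NavierStokesRegularity.Theorems.PlaneStrainDoorProfileWeights

/-!
# nsreg-p1 ROUND-15 (planned doors S16 / S16′ / S16γ): the PROFILE ENSTROPHY engine — a door-class profile with
# space–time Type-I decay and sign-definite enstrophy production vanishes identically

For a profile `v` of the door class (Type I in time, continuous on the open backward slab, unit-viscosity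
Oseen–Duhamel identity between negative times, divergence-free slices) with SPACE–TIME Type-I decay
`‖v(t,x)‖ ≤ D/(‖x‖+√(−t))`:

* `integral_frobeniusNormSq_fderiv_antitone` — the profile enstrophy `G(t) = ∫ |∇v(t)|²_F` is finite and, if the trilinear term
  `∫ ⟪Δv(s), (v(s)·∇)v(s)⟫ ≤ 0` on every slice, NON-INCREASING on `(−∞,0)` (the tree's enstrophy balance
  `IsSmoothSpaceTimeOn.enstrophy_balance` on every shifted window `[t₁,t₂] ↦ [0,T]`, the slice identity
  `integral_sum_inner_fderiv_eq_of_momentum`, and the scale-invariant bounds `profileGradientDecay` /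
  `exists_classical_scaleInvariantBounds`, which put every slice in the identity's class);
* `integral_frobeniusNormSq_fderiv_le` — `G(t) ≤ 3K² I₁ (−t)^{−1/2}` (weights: `PlaneStrainDoorProfileWeights`), so
  `G(−∞) = 0`;
* `eq_zero_of_integral_inner_laplacian_convect_nonpos` — **the engine**: `G ≡ 0`, each slice has zero gradient,
  hence is constant, hence zero by the decay.

Its three instances (Betchov's sign rules of `MillerEnstrophyProductionIdentity`) are the profile Liouville theorems
of the planned doors S16 (production-free), S16′ (plane strain), S16γ (tube strain) in
`PlaneStrainDoorProfileLiouvilles`.  Seat nsreg-p6 g8.  WHAT THIS IS NOT: not NS regularity (Clay A) — a Liouville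
theorem for a CONDITIONAL door's profile class under a sign hypothesis; not a route open.
-/

noncomputable section

open MeasureTheory Set Function Filter Topology InnerProductSpace
open scoped ENNReal NNReal RealInnerProductSpace Laplacian
open Literature.Analysis Literature.Analysis.FluidPDE
open Summit.NavierStokesRegularity.NavierStokesRegularity.Theorems.PlaneStrainDoorProfileGradientDecay
open Summit.NavierStokesRegularity.NavierStokesRegularity.Theorems.PlaneStrainDoorProfileWeights

-- the summit and its single sub-problem share the name (CONVENTIONS §1), as in every Theorems file
set_option linter.dupNamespace false

namespace Summit.NavierStokesRegularity.NavierStokesRegularity.Theorems.PlaneStrainDoorProfileEnstrophyLiouville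

/-! ### The profile enstrophy -/

variable {C D : ℝ} {v : ℝ → EuclideanSpace ℝ (Fin 3) → EuclideanSpace ℝ (Fin 3)}
  {q : ℝ → EuclideanSpace ℝ (Fin 3) → ℝ}

/-- **The enstrophy production of a profile slice is non-positive under the sign hypothesis**: for a classical
solution `(v,q)` on the past with the scale-invariant bounds and `∫⟪Δv(t), (v(t)·∇)v(t)⟫ ≤ 0`,
`∫ Σᵢ ⟪∂ᵢv(t), ∂ᵢ∂ₜv(t)⟫ ≤ 0` at every `t < 0` (the slice identity `integral_sum_inner_fderiv_eq_of_momentum`). -/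
theorem integral_sum_inner_fderiv_timeDeriv_nonpos (hcl : IsClassicalNSSolutionOn (Iio 0) 1 0 v q)
    (hrate : HasTypeITimeDecay C v) {K : ℝ}
    (hK : ∀ t < (0 : ℝ), ∀ x : EuclideanSpace ℝ (Fin 3),
        (‖x‖ + Real.sqrt (-t)) * ‖v t x‖ ≤ K ∧
        (‖x‖ + Real.sqrt (-t)) ^ 2 * ‖fderiv ℝ (v t) x‖ ≤ K ∧
        (‖x‖ + Real.sqrt (-t)) ^ 3 * ‖iteratedFDeriv ℝ 2 (v t) x‖ ≤ K ∧
        (‖x‖ + Real.sqrt (-t)) ^ 4 * ‖iteratedFDeriv ℝ 3 (v t) x‖ ≤ K ∧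
        (‖x‖ + Real.sqrt (-t)) ^ 2 * |q t x| ≤ K ∧
        (‖x‖ + Real.sqrt (-t)) ^ 3 * ‖gradient (q t) x‖ ≤ K ∧
        (‖x‖ + Real.sqrt (-t)) ^ 3 * ‖timeDeriv v t x‖ ≤ K ∧
        (‖x‖ + Real.sqrt (-t)) ^ 4 * ‖fderiv ℝ (timeDeriv v t) x‖ ≤ K)
    (hsign : ∀ s < (0 : ℝ), ∫ x, ⟪(Δ (v s)) x, convect (v s) (v s) x⟫_ℝ ≤ 0)
    {t : ℝ} (ht : t < 0) :
    ∫ x, ∑ i, ⟪fderiv ℝ (v t) x (EuclideanSpace.basisFun (Fin 3) ℝ i),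
        fderiv ℝ (timeDeriv v t) x (EuclideanSpace.basisFun (Fin 3) ℝ i)⟫_ℝ ≤ 0 := by
  have ha : 0 < Real.sqrt (-t) := Real.sqrt_pos.2 (by linarith)
  -- the momentum equation with the two-sided time derivative
  have hWdef : timeDeriv v t = timeDerivWithin (Iio 0) v t := by
    funext x; rw [timeDerivWithin_eq_deriv isOpen_Iio ht, timeDeriv_apply]
  have hmom : ∀ x, timeDeriv v t x + convect (v t) (v t) x = (1 : ℝ) • (Δ (v t)) x - gradient (q t) x := by
    intro x
    have h := hcl.momentum t ht x
    rw [hWdef]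
    simpa using h
  have hWc : ContDiff ℝ 1 (timeDeriv v t) := by
    rw [hWdef]
    exact ((hcl.smooth_velocity.timeDerivWithin isOpen_Iio.uniqueDiffOn).contDiff_slice ht).of_le
      (by norm_cast)
  -- the `L²` memberships from the scale-invariant bounds
  have hv1 : ∫⁻ x, ‖iteratedFDeriv ℝ 1 (v t) x‖ₑ ^ 2 < ⊤ :=
    lintegral_enorm_sq_lt_top_of_weight_le ha (m := 2) le_rfl fun x => by
      rw [norm_iteratedFDeriv_one]; exact (hK t ht x).2.1
  have hv2 : ∫⁻ x, ‖iteratedFDeriv ℝ 2 (v t) x‖ₑ ^ 2 < ⊤ :=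
    lintegral_enorm_sq_lt_top_of_weight_le ha (m := 3) (by norm_num) fun x => (hK t ht x).2.2.1
  have hv3 : ∫⁻ x, ‖iteratedFDeriv ℝ 3 (v t) x‖ₑ ^ 2 < ⊤ :=
    lintegral_enorm_sq_lt_top_of_weight_le ha (m := 4) (by norm_num) fun x => (hK t ht x).2.2.2.1
  have hW0 : ∫⁻ x, ‖timeDeriv v t x‖ₑ ^ 2 < ⊤ :=
    lintegral_enorm_sq_lt_top_of_weight_le ha (m := 3) (by norm_num) fun x => (hK t ht x).2.2.2.2.2.2.1
  have hW1 : ∫⁻ x, ‖iteratedFDeriv ℝ 1 (timeDeriv v t) x‖ₑ ^ 2 < ⊤ :=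
    lintegral_enorm_sq_lt_top_of_weight_le ha (m := 4) (by norm_num) fun x => by
      rw [norm_iteratedFDeriv_one]; exact (hK t ht x).2.2.2.2.2.2.2
  have hq0 : ∫⁻ x, ‖q t x‖ₑ ^ 2 < ⊤ :=
    lintegral_enorm_sq_lt_top_of_weight_le ha (m := 2) le_rfl fun x => by
      rw [Real.norm_eq_abs]; exact (hK t ht x).2.2.2.2.1
  have hq1 : ∫⁻ x, ‖iteratedFDeriv ℝ 1 (q t) x‖ₑ ^ 2 < ⊤ :=
    lintegral_enorm_sq_lt_top_of_weight_le ha (m := 3) (by norm_num) fun x => by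
      have h : ‖iteratedFDeriv ℝ 1 (q t) x‖ = ‖gradient (q t) x‖ := by
        rw [gradient, LinearIsometryEquiv.norm_map, ← norm_iteratedFDeriv_fderiv, norm_iteratedFDeriv_zero]
      rw [h]; exact (hK t ht x).2.2.2.2.2.1
  have hid := integral_sum_inner_fderiv_eq_of_momentum (hcl.contDiff_velocity ht) hWc
    ((hcl.contDiff_pressure ht).of_le (by norm_cast)) hmom (hcl.divFree t ht)
    (fun x => hrate t ht x) hv1 hv2 hv3 hW0 hW1 hq0 hq1
  rw [hid]
  have h0 : 0 ≤ ∫ x, ‖(Δ (v t)) x‖ ^ 2 := integral_nonneg fun x => sq_nonneg _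
  have hs := hsign t ht
  linarith

set_option maxHeartbeats 400000 in
/-- **The profile enstrophy is non-increasing** under the sign hypothesis: `∫|∇v(t₂)|²_F ≤ ∫|∇v(t₁)|²_F` for
`t₁ < t₂ < 0` — the tree's enstrophy balance on the shifted window `[t₁,t₂] ↦ [0,T]` (the classical solution
restricted to `Icc 0 T`, its one-sided time derivative there being the two-sided time derivative of `v`, the
uniform `L²` bounds of `D v` and `D ∂ₜv` from the scale-invariant bounds with the weight `‖x‖ + √(−t₂)`), and
slice-wise non-positive production (`integral_sum_inner_fderiv_timeDeriv_nonpos`). -/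
theorem integral_frobeniusNormSq_fderiv_antitone (hcl : IsClassicalNSSolutionOn (Iio 0) 1 0 v q)
    (hrate : HasTypeITimeDecay C v) {K : ℝ}
    (hK : ∀ t < (0 : ℝ), ∀ x : EuclideanSpace ℝ (Fin 3),
        (‖x‖ + Real.sqrt (-t)) * ‖v t x‖ ≤ K ∧
        (‖x‖ + Real.sqrt (-t)) ^ 2 * ‖fderiv ℝ (v t) x‖ ≤ K ∧
        (‖x‖ + Real.sqrt (-t)) ^ 3 * ‖iteratedFDeriv ℝ 2 (v t) x‖ ≤ K ∧
        (‖x‖ + Real.sqrt (-t)) ^ 4 * ‖iteratedFDeriv ℝ 3 (v t) x‖ ≤ K ∧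
        (‖x‖ + Real.sqrt (-t)) ^ 2 * |q t x| ≤ K ∧
        (‖x‖ + Real.sqrt (-t)) ^ 3 * ‖gradient (q t) x‖ ≤ K ∧
        (‖x‖ + Real.sqrt (-t)) ^ 3 * ‖timeDeriv v t x‖ ≤ K ∧
        (‖x‖ + Real.sqrt (-t)) ^ 4 * ‖fderiv ℝ (timeDeriv v t) x‖ ≤ K)
    (hsign : ∀ s < (0 : ℝ), ∫ x, ⟪(Δ (v s)) x, convect (v s) (v s) x⟫_ℝ ≤ 0)
    {t₁ t₂ : ℝ} (h12 : t₁ < t₂) (ht₂ : t₂ < 0) :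
    ∫ x, frobeniusNormSq (fderiv ℝ (v t₂) x) ≤ ∫ x, frobeniusNormSq (fderiv ℝ (v t₁) x) := by
  set e := EuclideanSpace.basisFun (Fin 3) ℝ with he
  set T : ℝ := t₂ - t₁ with hT
  have hT0 : 0 < T := by rw [hT]; linarith
  set u : ℝ → EuclideanSpace ℝ (Fin 3) → EuclideanSpace ℝ (Fin 3) := fun τ => v (τ + t₁) with hu
  set p : ℝ → EuclideanSpace ℝ (Fin 3) → ℝ := fun τ => q (τ + t₁) with hp
  -- the shifted solution is classical on `Iio (-t₁) ⊇ Icc 0 T`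
  have hclI : IsClassicalNSSolutionOn (Iio (-t₁)) 1 0 u p := by
    have h := hcl.comp_add_right t₁
    have h0 : (fun t => (0 : ℝ → EuclideanSpace ℝ (Fin 3) → EuclideanSpace ℝ (Fin 3)) (t + t₁)) = 0 := rfl
    have hS : ((· + t₁) ⁻¹' Iio (0 : ℝ)) = Iio (-t₁) := by
      ext τ; simp only [mem_preimage, mem_Iio]; constructor <;> intro h' <;> linarith
    rw [h0, hS] at h
    exact h
  have hsub : Icc 0 T ⊆ Iio (-t₁) := fun τ hτ => by
    simp only [mem_Iio]; rw [hT] at hτ; linarith [hτ.2]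
  have hU : UniqueDiffOn ℝ (Icc 0 T) := uniqueDiffOn_Icc hT0
  have hclS : IsClassicalNSSolutionOn (Icc 0 T) 1 0 u p := hclI.mono hsub hU
  -- the within-slab time derivative is the time derivative of `v`
  have hW : ∀ τ ∈ Icc 0 T, timeDerivWithin (Icc 0 T) u τ = timeDeriv v (τ + t₁) := by
    intro τ hτ; funext x
    rw [hclI.smooth_velocity.timeDerivWithin_eq_of_subset hsub hU hτ x,
      timeDerivWithin_eq_deriv isOpen_Iio (hsub hτ) u x, timeDeriv_apply]
    exact deriv_comp_add_const (fun s => v s x) t₁ τ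
  -- uniform `L²` bounds on the slab with the weight `‖x‖ + √(-t₂)`
  set a : ℝ := Real.sqrt (-t₂) with ha
  have ha0 : 0 < a := Real.sqrt_pos.2 (by linarith)
  have hwt : ∀ τ ∈ Icc 0 T, τ + t₁ < 0 ∧ a ≤ Real.sqrt (-(τ + t₁)) := fun τ hτ => by
    have h1 : τ + t₁ ≤ t₂ := by rw [hT] at hτ; linarith [hτ.2]
    exact ⟨by linarith, Real.sqrt_le_sqrt (by linarith)⟩
  have hmono : ∀ τ ∈ Icc 0 T, ∀ (x : EuclideanSpace ℝ (Fin 3)) (m : ℕ) (r : ℝ), 0 ≤ r →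
      (‖x‖ + Real.sqrt (-(τ + t₁))) ^ m * r ≤ K → (‖x‖ + a) ^ m * r ≤ K := by
    intro τ hτ x m r hr h
    refine le_trans (mul_le_mul_of_nonneg_right (pow_le_pow_left₀ (by positivity) ?_ m) hr) h
    linarith [(hwt τ hτ).2]
  have hD1 : ∀ τ ∈ Icc 0 T, ∀ x, (‖x‖ + a) ^ 2 * ‖iteratedFDeriv ℝ 1 (u τ) x‖ ≤ K := by
    intro τ hτ x
    rw [norm_iteratedFDeriv_one]
    exact hmono τ hτ x 2 _ (norm_nonneg _) (hK _ (hwt τ hτ).1 x).2.1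
  have hDW : ∀ τ ∈ Icc 0 T, ∀ x,
      (‖x‖ + a) ^ 4 * ‖iteratedFDeriv ℝ 1 (timeDerivWithin (Icc 0 T) u τ) x‖ ≤ K := by
    intro τ hτ x
    rw [hW τ hτ, norm_iteratedFDeriv_one]
    exact hmono τ hτ x 4 _ (norm_nonneg _) (hK _ (hwt τ hτ).1 x).2.2.2.2.2.2.2
  set I₁ : ℝ≥0∞ := ∫⁻ x : EuclideanSpace ℝ (Fin 3), ‖K ^ 2 * ((‖x‖ + a) ^ (2 * 2))⁻¹‖ₑ with hI₁
  set I₂ : ℝ≥0∞ := ∫⁻ x : EuclideanSpace ℝ (Fin 3), ‖K ^ 2 * ((‖x‖ + a) ^ (2 * 4))⁻¹‖ₑ with hI₂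
  have hI₁t : I₁ < ⊤ := ((integrable_inv_norm_add_pow ha0 (show 4 ≤ 2 * 2 by norm_num)).const_mul (K ^ 2)).2
  have hI₂t : I₂ < ⊤ := ((integrable_inv_norm_add_pow ha0 (show 4 ≤ 2 * 4 by norm_num)).const_mul (K ^ 2)).2
  have hC₁ : ∀ τ ∈ Icc 0 T, ∫⁻ x, ‖iteratedFDeriv ℝ 1 (u τ) x‖ₑ ^ 2 ≤ (I₁.toNNReal : ℝ≥0∞) := by
    intro τ hτ
    rw [ENNReal.coe_toNNReal hI₁t.ne]
    exact lintegral_enorm_sq_le_of_weight_le ha0 (hD1 τ hτ)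
  have hC₂ : ∀ τ ∈ Icc 0 T,
      ∫⁻ x, ‖iteratedFDeriv ℝ 1 (timeDerivWithin (Icc 0 T) u τ) x‖ₑ ^ 2 ≤ (I₂.toNNReal : ℝ≥0∞) := by
    intro τ hτ
    rw [ENNReal.coe_toNNReal hI₂t.ne]
    exact lintegral_enorm_sq_le_of_weight_le ha0 (hDW τ hτ)
  -- the enstrophy balance on the slab
  obtain ⟨-, -, hbal⟩ := hclS.smooth_velocity.enstrophy_balance hT0 hC₁ hC₂
  have hb := hbal T ⟨hT0, le_rfl⟩
  -- slice-wise non-positive production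
  have hΦ : ∀ τ ∈ Icc 0 T, (∫ x, 2 * ∑ i, ⟪fderiv ℝ (u τ) x (e i),
      fderiv ℝ (timeDerivWithin (Icc 0 T) u τ) x (e i)⟫_ℝ) ≤ 0 := by
    intro τ hτ
    rw [hW τ hτ, integral_const_mul]
    have h := integral_sum_inner_fderiv_timeDeriv_nonpos hcl hrate hK hsign (hwt τ hτ).1
    simp only [hu]
    linarith
  have hint : ∫ τ in (0 : ℝ)..T, ∫ x, 2 * ∑ i, ⟪fderiv ℝ (u τ) x (e i),
      fderiv ℝ (timeDerivWithin (Icc 0 T) u τ) x (e i)⟫_ℝ ≤ 0 := by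
    rw [intervalIntegral.integral_of_le hT0.le]
    exact setIntegral_nonpos measurableSet_Ioc fun τ hτ => hΦ τ ⟨hτ.1.le, hτ.2⟩
  have hu0 : u 0 = v t₁ := by simp [hu]
  have huT : u T = v t₂ := by simp [hu, hT]
  rw [huT, hu0] at hb
  linarith

/-- **Decay of the profile enstrophy**: `∫ |∇v(t)|²_F ≤ 3 K² I₁ (√(−t))⁻¹` with `I₁ = ∫ (‖y‖+1)^{−4} dy`, from
`‖∇v(t,x)‖ ≤ K/(‖x‖+√(−t))²` and the scaling law. -/
theorem integral_frobeniusNormSq_fderiv_le {K : ℝ} {t : ℝ} (ht : t < 0) (hd : ContDiff ℝ 1 (v t))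
    (hK : ∀ x : EuclideanSpace ℝ (Fin 3), (‖x‖ + Real.sqrt (-t)) ^ 2 * ‖fderiv ℝ (v t) x‖ ≤ K) :
    ∫ x, frobeniusNormSq (fderiv ℝ (v t) x) ≤
      3 * K ^ 2 * (∫ y : EuclideanSpace ℝ (Fin 3), ((‖y‖ + 1) ^ 4)⁻¹) * (Real.sqrt (-t))⁻¹ := by
  set a : ℝ := Real.sqrt (-t) with ha
  have ha0 : 0 < a := Real.sqrt_pos.2 (by linarith)
  have hg := (integrable_inv_norm_add_pow ha0 (le_refl 4)).const_mul (3 * K ^ 2)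
  have hpt : ∀ x, frobeniusNormSq (fderiv ℝ (v t) x) ≤ 3 * K ^ 2 * ((‖x‖ + a) ^ 4)⁻¹ := by
    intro x
    have hxa : 0 < (‖x‖ + a) ^ 2 := pow_pos (add_pos_of_nonneg_of_pos (norm_nonneg _) ha0) _
    have h1 : ‖fderiv ℝ (v t) x‖ ≤ K / (‖x‖ + a) ^ 2 := by
      rw [le_div_iff₀ hxa, mul_comm]; exact hK x
    have h2 : ‖fderiv ℝ (v t) x‖ ^ 2 ≤ K ^ 2 * ((‖x‖ + a) ^ 4)⁻¹ := by
      calc ‖fderiv ℝ (v t) x‖ ^ 2 ≤ (K / (‖x‖ + a) ^ 2) ^ 2 := pow_le_pow_left₀ (norm_nonneg _) h1 2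
        _ = K ^ 2 * ((‖x‖ + a) ^ 4)⁻¹ := by rw [div_pow, ← pow_mul]; ring
    linarith [BradshawTsai2017.frobeniusNormSq_le_three_mul_norm_sq (fderiv ℝ (v t) x)]
  -- integrability of the Frobenius density (continuous, dominated)
  have hF : Integrable (fun x => frobeniusNormSq (fderiv ℝ (v t) x)) volume :=
    hg.mono' (continuous_frobeniusNormSq_fderiv hd (by simp)).aestronglyMeasurable
      (Eventually.of_forall fun x => by
        rw [Real.norm_of_nonneg (frobeniusNormSq_nonneg _)]; exact hpt x)
  calc ∫ x, frobeniusNormSq (fderiv ℝ (v t) x) ≤ ∫ x, 3 * K ^ 2 * ((‖x‖ + a) ^ 4)⁻¹ :=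
        integral_mono hF hg hpt
    _ = 3 * K ^ 2 * (∫ y : EuclideanSpace ℝ (Fin 3), ((‖y‖ + 1) ^ 4)⁻¹) * a⁻¹ := by
        rw [integral_const_mul, integral_inv_norm_add_pow_four ha0]; ring

/-- **THE ENGINE.** A door-class profile with space–time Type-I decay whose trilinear enstrophy production
`∫⟪Δv(s), (v(s)·∇)v(s)⟫` is `≤ 0` on every slice vanishes identically: its enstrophy `∫|∇v(s)|²_F` is
non-increasing in `s` and tends to `0` as `s → −∞`, hence vanishes; every slice is then constant, and a constant
slice with Type-I decay is zero. -/
theorem eq_zero_of_integral_inner_laplacian_convect_nonpos (hrate : HasTypeITimeDecay C v)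
    (hdec : HasTypeIDecay D v) (hcont : ContinuousOn (uncurry v) (Iio (0 : ℝ) ×ˢ univ))
    (hmild : ∀ s t : ℝ, s < t → t < 0 → ∀ x,
      v t x = UnboundedOperators.heatExtension (v s) (t - s) x - oseenDuhamel 1 s v v t x)
    (hdiv : ∀ t < 0, VectorCalculus.IsDivFree (v t))
    (hsign : ∀ s < (0 : ℝ), ∫ x, ⟪(Δ (v s)) x, convect (v s) (v s) x⟫_ℝ ≤ 0) :
    ∀ s < (0 : ℝ), ∀ y, v s y = 0 := by
  obtain ⟨q, K, hcl, hK0, hK⟩ := exists_classical_scaleInvariantBounds hrate hdec hcont hmild hdiv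
  set I : ℝ := ∫ y : EuclideanSpace ℝ (Fin 3), ((‖y‖ + 1) ^ 4)⁻¹ with hI
  have hI0 : 0 ≤ I := integral_nonneg fun y => by positivity
  set M : ℝ := 3 * K ^ 2 * I with hM
  have hM0 : 0 ≤ M := by positivity
  intro s hs
  have hd1 : ContDiff ℝ 1 (v s) := (hcl.contDiff_velocity hs).of_le (by norm_cast)
  -- the enstrophy of the slice `s` vanishes
  have hG0 : ∫ x, frobeniusNormSq (fderiv ℝ (v s) x) = 0 := by
    refine le_antisymm ?_ (integral_nonneg fun x => frobeniusNormSq_nonneg _)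
    refine le_of_forall_pos_le_add fun ε hε => ?_
    rw [zero_add]
    -- an earlier time `t' < s` with `M / √(-t') ≤ ε`
    set t' : ℝ := min (s - 1) (-((M / ε) ^ 2 + 1)) with ht'
    have ht's : t' < s := lt_of_le_of_lt (min_le_left _ _) (by linarith)
    have ht'0 : t' < 0 := by linarith
    have hneg : (M / ε) ^ 2 ≤ -t' := by
      have h := min_le_right (s - 1) (-((M / ε) ^ 2 + 1))
      rw [← ht'] at h
      linarith
    have hsqrt : M / ε ≤ Real.sqrt (-t') := by
      rw [← Real.sqrt_sq (div_nonneg hM0 hε.le)]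
      exact Real.sqrt_le_sqrt hneg
    have hsq0 : 0 < Real.sqrt (-t') := Real.sqrt_pos.2 (by linarith)
    have hmono := integral_frobeniusNormSq_fderiv_antitone hcl hrate hK hsign ht's hs
    have hdecay := integral_frobeniusNormSq_fderiv_le ht'0
      ((hcl.contDiff_velocity ht'0).of_le (by norm_cast)) (fun x => (hK t' ht'0 x).2.1)
    have hMε : M * (Real.sqrt (-t'))⁻¹ ≤ ε := by
      rw [← div_eq_mul_inv, div_le_iff₀ hsq0]
      calc M = ε * (M / ε) := by field_simp
        _ ≤ ε * Real.sqrt (-t') := mul_le_mul_of_nonneg_left hsqrt hε.le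
    calc ∫ x, frobeniusNormSq (fderiv ℝ (v s) x) ≤ ∫ x, frobeniusNormSq (fderiv ℝ (v t') x) := hmono
      _ ≤ M * (Real.sqrt (-t'))⁻¹ := by rw [hM, hI]; exact hdecay
      _ ≤ ε := hMε
  -- hence the gradient of the slice vanishes everywhere
  have ha : 0 < Real.sqrt (-s) := Real.sqrt_pos.2 (by linarith)
  have hg := (integrable_inv_norm_add_pow ha (le_refl 4)).const_mul (3 * K ^ 2)
  have hF : Integrable (fun x => frobeniusNormSq (fderiv ℝ (v s) x)) volume := by
    refine hg.mono' (continuous_frobeniusNormSq_fderiv hd1 (by simp)).aestronglyMeasurable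
      (Eventually.of_forall fun x => ?_)
    rw [Real.norm_of_nonneg (frobeniusNormSq_nonneg _)]
    have hxa : 0 < (‖x‖ + Real.sqrt (-s)) ^ 2 :=
      pow_pos (add_pos_of_nonneg_of_pos (norm_nonneg _) ha) _
    have h1 : ‖fderiv ℝ (v s) x‖ ≤ K / (‖x‖ + Real.sqrt (-s)) ^ 2 := by
      rw [le_div_iff₀ hxa, mul_comm]; exact (hK s hs x).2.1
    have h2 : ‖fderiv ℝ (v s) x‖ ^ 2 ≤ K ^ 2 * ((‖x‖ + Real.sqrt (-s)) ^ 4)⁻¹ := by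
      calc ‖fderiv ℝ (v s) x‖ ^ 2 ≤ (K / (‖x‖ + Real.sqrt (-s)) ^ 2) ^ 2 :=
            pow_le_pow_left₀ (norm_nonneg _) h1 2
        _ = K ^ 2 * ((‖x‖ + Real.sqrt (-s)) ^ 4)⁻¹ := by rw [div_pow, ← pow_mul]; ring
    linarith [BradshawTsai2017.frobeniusNormSq_le_three_mul_norm_sq (fderiv ℝ (v s) x)]
  have hae := (integral_eq_zero_iff_of_nonneg (fun x => frobeniusNormSq_nonneg _) hF).1 hG0
  have hzero : (fun x => frobeniusNormSq (fderiv ℝ (v s) x)) = fun _ => (0 : ℝ) :=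
    (Continuous.ae_eq_iff_eq volume (continuous_frobeniusNormSq_fderiv hd1 (by simp)) continuous_const).1 hae
  have hDz : ∀ x, fderiv ℝ (v s) x = 0 := fun x => by
    have h := congrFun hzero x
    exact (frobeniusNormSq_eq_zero_iff _).1 h
  -- a slice with zero gradient is constant, and a constant Type-I slice is zero
  have hconst : ∀ x y, v s x = v s y :=
    fun x y => is_const_of_fderiv_eq_zero (hd1.differentiable (by simp)) hDz x y
  have hD : 0 ≤ D := by
    have h := hdec s hs 0
    have h0 : 0 ≤ D / (‖(0 : EuclideanSpace ℝ (Fin 3))‖ + Real.sqrt (-s)) := (norm_nonneg _).trans h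
    rw [norm_zero, zero_add] at h0
    exact (div_nonneg_iff.1 h0).elim (fun h' => h'.1) fun h' => absurd h'.2 (not_le.2 ha)
  intro y
  rw [← norm_le_zero_iff]
  refine le_of_forall_pos_le_add fun ε hε => ?_
  rw [zero_add]
  -- a far point `z` with `D/(‖z‖ + √(-s)) ≤ ε`
  set R : ℝ := D / ε + 1 with hR
  have hR0 : 0 ≤ R := by positivity
  set z : EuclideanSpace ℝ (Fin 3) := R • EuclideanSpace.basisFun (Fin 3) ℝ 0 with hz
  have hzn : ‖z‖ = R := by
    rw [hz, norm_smul, (EuclideanSpace.basisFun (Fin 3) ℝ).orthonormal.1 0, mul_one, Real.norm_of_nonneg hR0]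
  have hzs : 0 < ‖z‖ + Real.sqrt (-s) := by positivity
  rw [hconst y z]
  calc ‖v s z‖ ≤ D / (‖z‖ + Real.sqrt (-s)) := hdec s hs z
    _ ≤ D / R := by
        rw [hzn]
        exact div_le_div_of_nonneg_left hD (by positivity) (by linarith [ha.le])
    _ ≤ ε := by
        rw [div_le_iff₀ (by positivity), hR]
        nlinarith [div_mul_cancel₀ D hε.ne']

end Summit.NavierStokesRegularity.NavierStokesRegularity.Theorems.PlaneStrainDoorProfileEnstrophyLiouville

end
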